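import Literature.AlgebraicGeometry.Motives.MixedHodgeStructureCatTensorStructure
import Mathlib.LinearAlgebra.Trace
import HarnessLib

/-!
# Rigidity of `MixedHodgeStructureCat` on finite-dimensional objects: coevaluation, the zig-zag identities, the categorical dimension

Layer `Literature/AlgebraicGeometry/Motives` (lane `lit-hodgefound`), continuing g45-#14 (`evalPairing X : X^∨ ⊗ X ⟶ ℚ(0)`, `ihomIsoDualTensor`) and g45-#15
(associator, braiding, unitors).  Deligne–Milne §1: a tensor category with internal Homs in which every object is reflexive is RIGID — each `X` has the dual
`X^∨ = Hom(X, 1)` with evaluation `ev_X : X^∨ ⊗ X → 1` (1.6.5) and coevaluation `δ : 1 → X ⊗ X^∨`, subject to the two triangle (zig-zag) identities; the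
category of `ℚ`-mixed Hodge structures is the standard example of a (neutral Tannakian, in particular rigid abelian tensor) category (Deligne–Milne Ex. 1.10 ∕
Deligne, *Hodge II*, 2.3.5–2.3.7: the fibre functor «espace vectoriel sous-jacent» is exact, faithful and compatible with `⊗`).  This file PROVES the rigidity
data for the finite-dimensional objects of `MixedHodgeStructureCat`, in the normal form of Mathlib's `ExactPairing X X^∨`:

* §1 the **coevaluation `coevHom X : ℚ(0) ⟶ X ⊗ X^∨`**, `q ↦ q · Σᵢ eᵢ ⊗ eᵢ^*` — the image of `𝟙_X` under `Hom(X, X) ≃ Hom(ℚ(0), Hom(X, X)) ≅ Hom(ℚ(0), X^∨ ⊗ X)`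
  (g45-#13 `homLinearEquivTateHom`, g45-#14 `ihomIsoDualTensor`) followed by the braiding; its value (`coevHom_toLinearMap_apply`) and the key identity
  `dualTensorHom (δ-tensor) = id` (`dualTensorHom_coevTensor`);
* §2 the inverse unitors on vectors (`leftUnitor_inv_toLinearMap_apply`, `rightUnitor_inv_toLinearMap_apply`);
* §3 **the zig-zag identities** **`evaluation_coevaluation : (δ ⊗ 𝟙_X) ≫ α ≫ (𝟙_X ⊗ ev) = λ ≫ ρ⁻¹`** and
  **`coevaluation_evaluation : (𝟙_{X^∨} ⊗ δ) ≫ α⁻¹ ≫ (ev ⊗ 𝟙_{X^∨}) = ρ ≫ λ⁻¹`**;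
* §4 **the categorical dimension**: `δ ≫ β ≫ ev = (dim_ℚ X) · 𝟙_{ℚ(0)}` (`coevHom_braiding_evalPairing`; the trace of the identity, Deligne–Milne (1.7.3) ff.).

Everything is PROVED (linear algebra: Mathlib `dualTensorHom`, `dualTensorHomEquivOfBasis_symm_cancel_right`, `LinearMap.trace_eq_contract`); no named fact,
no instance (in particular no `ExactPairing` ∕ `RigidCategory` instance — this lane declares none), no notation.  Data: `coevTensor`, `coevHom`.

Sources, verbatim (through the tree's files and Mathlib).  P. Deligne, J. S. Milne, *Tannakian categories*, in LNM 900 (1982) [DeligneMilne1982Tannakian], §1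
(1.6.5) `ev_X`, Def. 1.7 (reflexive objects, rigid tensor categories: «`Hom(X, Y) ≅ X^∨ ⊗ Y`», the maps `δ : 1 → X^∨ ⊗ X`… with the compatibilities), (1.7.3)–(1.7.5)
(trace and rank `dim X`), Ex. 1.10 ∕ §1 end (Hodge structures).  P. Deligne, *Théorie de Hodge II* (1971) [DeligneHodgeII1971], 1.1.6, 1.1.12, 2.3.5.  E. Cattani et
al. (eds.), *Hodge Theory* (2014) [CattaniElZeinGriffithsLe2014], Ch. 3 §3.2.2.7 p. 163 (dual and tensor of MHS).

## Main results

* §1 `coevTensor`, **`dualTensorHom_coevTensor`**, `contractLeft_coevTensor`, **`coevHom`**, **`coevHom_toLinearMap_apply`**.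
* §2 `leftUnitor_inv_toLinearMap_apply`, `rightUnitor_inv_toLinearMap_apply`.
* §3 `evaluation_coevaluation_aux`, **`evaluation_coevaluation`**, `coevaluation_evaluation_aux`, **`coevaluation_evaluation`**.
* §4 **`coevHom_braiding_evalPairing`** (`δ ≫ β ≫ ev = dim X · 𝟙`).

## References

* [DeligneMilne1982Tannakian] P. Deligne, J. S. Milne, Tannakian categories, in LNM 900 (1982), §1 (1.6.5), Def. 1.7, (1.7.3)–(1.7.5), Ex. 1.10.
* [DeligneHodgeII1971] P. Deligne, Théorie de Hodge II, Publ. Math. IHÉS 40 (1971), 1.1.6, 1.1.12, 2.3.5.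
* [CattaniElZeinGriffithsLe2014] E. Cattani et al. (eds.), Hodge Theory, Princeton Math. Notes 49 (2014), Ch. 3 §3.2.2.7 p. 163.

## Provenance

Lane `lit-hodgefound` (summit `HodgeConjecture`), seat `lit-hodgefound-p36` (literature-prover, generation 45, row g45-#17).
-/

noncomputable section

open CategoryTheory CategoryTheory.Limits
open scoped TensorProduct

namespace Literature.AlgebraicGeometry.Motives

universe u

namespace MixedHodgeStructureCat

variable (X : MixedHodgeStructureCat.{u}) [Module.Finite ℚ X]

/-! ## §1 The coevaluation -/

/-- The tensor `Σᵢ eᵢ^* ⊗ eᵢ ∈ X^∨ ⊗ X` corresponding to `𝟙_X` under `Hom(X, X) ≅ X^∨ ⊗ X` (the tree's `homToTensor`, i.e. Mathlib's `(dualTensorHomEquiv).symm`).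
[cite: DeligneMilne1982Tannakian, §1 Def. 1.7] -/
def coevTensor : ↥(tensorObj (of X.str.dual) X) := (MixedHodgeStructure.homToTensor X.str X.str).toLinearMap LinearMap.id

/-- **`Σᵢ eᵢ^*(v) eᵢ = v`**: under `X^∨ ⊗ X → End(X)` the tensor `coevTensor X` is the identity. [cite: DeligneMilne1982Tannakian, §1 Def. 1.7] -/
theorem dualTensorHom_coevTensor : dualTensorHom ℚ X X (coevTensor X) = LinearMap.id := by
  rw [coevTensor, MixedHodgeStructure.homToTensor_toLinearMap, LinearEquiv.coe_coe, dualTensorHomEquiv]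
  exact dualTensorHomEquivOfBasis_symm_cancel_right _ _

/-- **`ev(Σᵢ eᵢ^* ⊗ eᵢ) = dim X`**: the contraction of `coevTensor X` is the trace of the identity. [cite: DeligneMilne1982Tannakian, §1 (1.7.3)–(1.7.5)] -/
theorem contractLeft_coevTensor : contractLeft ℚ X (coevTensor X) = (Module.finrank ℚ X : ℚ) := by
  rw [← LinearMap.trace_eq_contract_apply, dualTensorHom_coevTensor, LinearMap.trace_id]

/-- **The coevaluation `δ_X : ℚ(0) ⟶ X ⊗ X^∨`** — the morphism of MHS corresponding to `𝟙_X` under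
`Hom(X, X) ≃ Hom(ℚ(0), Hom(X, X)) ≅ Hom(ℚ(0), X^∨ ⊗ X) ≅ Hom(ℚ(0), X ⊗ X^∨)` (g45-#13 `homLinearEquivTateHom`, g45-#14 `ihomIsoDualTensor`, g45-#15 `braiding`).
[cite: DeligneMilne1982Tannakian, §1 Def. 1.7] [cite: DeligneHodgeII1971, 1.1.6 and 1.1.12] -/
def coevHom : unitObj.{u} ⟶ tensorObj X (of X.str.dual) :=
  homLinearEquivTateHom X X (𝟙 X) ≫ (ihomIsoDualTensor X X).hom ≫ (braiding (of X.str.dual) X).hom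

/-- **`δ_X(q) = q · Σᵢ eᵢ ⊗ eᵢ^*`.** [cite: DeligneMilne1982Tannakian, §1 Def. 1.7] -/
theorem coevHom_toLinearMap_apply (q : unitObj.{u}) :
    (coevHom X).toLinearMap q = q.down • TensorProduct.comm ℚ (Module.Dual ℚ X) X (coevTensor X) := by
  change (braiding (of X.str.dual) X).hom.toLinearMap
      ((ihomIsoDualTensor X X).hom.toLinearMap ((homLinearEquivTateHom X X (𝟙 X)).toLinearMap q)) = _
  have h : (homLinearEquivTateHom X X (𝟙 X)).toLinearMap q = q.down • (LinearMap.id : X →ₗ[ℚ] X) := rfl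
  rw [h, map_smul, map_smul]
  rfl

/-! ## §2 The inverse unitors on vectors -/

/-- `λ⁻¹(x) = 1 ⊗ x`. [cite: DeligneHodgeII1971, 2.1.13] -/
theorem leftUnitor_inv_toLinearMap_apply (x : X) : (leftUnitor X).inv.toLinearMap x = ULift.up (1 : ℚ) ⊗ₜ[ℚ] x := by
  have h : (leftUnitor X).hom.toLinearMap (ULift.up (1 : ℚ) ⊗ₜ[ℚ] x) = x := by
    rw [leftUnitor_hom_toLinearMap_apply_tmul, one_smul]
  conv_lhs => rw [← h]
  rw [← LinearMap.comp_apply, ← comp_toLinearMap, Iso.hom_inv_id]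
  rfl

/-- `ρ⁻¹(x) = x ⊗ 1`. [cite: DeligneHodgeII1971, 2.1.13] -/
theorem rightUnitor_inv_toLinearMap_apply (x : X) : (rightUnitor X).inv.toLinearMap x = x ⊗ₜ[ℚ] ULift.up (1 : ℚ) := by
  have h : (rightUnitor X).hom.toLinearMap (x ⊗ₜ[ℚ] ULift.up (1 : ℚ)) = x := by
    rw [rightUnitor_hom_toLinearMap_apply_tmul, one_smul]
  conv_lhs => rw [← h]
  rw [← LinearMap.comp_apply, ← comp_toLinearMap, Iso.hom_inv_id]
  rfl

/-! ## §3 The zig-zag identities -/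

/-- Linear-algebra core of `evaluation_coevaluation`: `(𝟙 ⊗ ev)(α((σ t) ⊗ x)) = (Σ φₖ(x) wₖ) ⊗ 1` for `t = Σ φₖ ⊗ wₖ ∈ X^∨ ⊗ X`.
[cite: DeligneMilne1982Tannakian, §1 Def. 1.7] -/
theorem evaluation_coevaluation_aux (x : X) (t : ↥(tensorObj (of X.str.dual) X)) :
    (tensorHom (𝟙 X) (evalPairing X)).toLinearMap ((associator X (of X.str.dual) X).hom.toLinearMap (TensorProduct.comm ℚ (Module.Dual ℚ X) X t ⊗ₜ[ℚ] x)) =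
      dualTensorHom ℚ X X t x ⊗ₜ[ℚ] ULift.up (1 : ℚ) := by
  induction t using TensorProduct.induction_on with
  | zero => simp only [map_zero, TensorProduct.zero_tmul, LinearMap.zero_apply]
  | tmul φ w =>
    have hu : ULift.up.{u} (φ x) = φ x • ULift.up.{u} (1 : ℚ) := ULift.ext _ _ (by simp)
    rw [TensorProduct.comm_tmul, associator_hom_toLinearMap_apply_tmul, tensorHom_toLinearMap_apply_tmul, evalPairing_toLinearMap_apply_tmul,
      dualTensorHom_apply, TensorProduct.smul_tmul, ← hu]
    rfl
  | add t₁ t₂ h₁ h₂ => simp only [map_add, TensorProduct.add_tmul, LinearMap.add_apply, h₁, h₂]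

/-- **The zig-zag identity `(δ_X ⊗ 𝟙_X) ≫ α ≫ (𝟙_X ⊗ ev_X) = λ_X ≫ ρ_X⁻¹`** (Mathlib's `ExactPairing.evaluation_coevaluation` for the pair `(X, X^∨)`).
[cite: DeligneMilne1982Tannakian, §1 Def. 1.7 and (1.6.5)] -/
theorem evaluation_coevaluation :
    tensorHom (coevHom X) (𝟙 X) ≫ (associator X (of X.str.dual) X).hom ≫ tensorHom (𝟙 X) (evalPairing X) = (leftUnitor X).hom ≫ (rightUnitor X).inv := by
  apply hom_ext
  refine TensorProduct.ext' fun q x => ?_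
  simp only [comp_toLinearMap, LinearMap.comp_apply]
  rw [tensorHom_toLinearMap_apply_tmul, coevHom_toLinearMap_apply, ← LinearEquiv.map_smul, evaluation_coevaluation_aux, map_smul, LinearMap.smul_apply,
    dualTensorHom_coevTensor, LinearMap.id_apply, leftUnitor_hom_toLinearMap_apply_tmul, rightUnitor_inv_toLinearMap_apply]
  rfl

/-- Linear-algebra core of `coevaluation_evaluation`: `(ev ⊗ 𝟙)(α⁻¹(ψ ⊗ σ t)) = 1 ⊗ (ψ ∘ Σ φₖ(−) wₖ)` for `t = Σ φₖ ⊗ wₖ ∈ X^∨ ⊗ X`.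
[cite: DeligneMilne1982Tannakian, §1 Def. 1.7] -/
theorem coevaluation_evaluation_aux (ψ : Module.Dual ℚ X) (t : ↥(tensorObj (of X.str.dual) X)) :
    (tensorHom (evalPairing X) (𝟙 (of X.str.dual))).toLinearMap
        ((associator (of X.str.dual) X (of X.str.dual)).inv.toLinearMap (ψ ⊗ₜ[ℚ] TensorProduct.comm ℚ (Module.Dual ℚ X) X t)) =
      ULift.up (1 : ℚ) ⊗ₜ[ℚ] (ψ ∘ₗ dualTensorHom ℚ X X t) := by
  induction t using TensorProduct.induction_on with
  | zero => simp only [map_zero, TensorProduct.tmul_zero, LinearMap.comp_zero]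
  | tmul φ w =>
    have hc : ψ ∘ₗ dualTensorHom ℚ X X (φ ⊗ₜ[ℚ] w) = ψ w • φ := by
      refine LinearMap.ext fun v => ?_
      rw [LinearMap.comp_apply, dualTensorHom_apply, map_smul, LinearMap.smul_apply, smul_eq_mul, smul_eq_mul, mul_comm]
    have hu : ULift.up.{u} (ψ w) = ψ w • ULift.up.{u} (1 : ℚ) := ULift.ext _ _ (by simp)
    rw [TensorProduct.comm_tmul, associator_inv_toLinearMap_apply_tmul, tensorHom_toLinearMap_apply_tmul, evalPairing_toLinearMap_apply_tmul, hc,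
      ← TensorProduct.smul_tmul, ← hu]
    rfl
  | add t₁ t₂ h₁ h₂ => simp only [map_add, TensorProduct.tmul_add, LinearMap.comp_add, h₁, h₂]

/-- **The zig-zag identity `(𝟙_{X^∨} ⊗ δ_X) ≫ α⁻¹ ≫ (ev_X ⊗ 𝟙_{X^∨}) = ρ_{X^∨} ≫ λ_{X^∨}⁻¹`** (Mathlib's `ExactPairing.coevaluation_evaluation` for `(X, X^∨)`).
[cite: DeligneMilne1982Tannakian, §1 Def. 1.7 and (1.6.5)] -/
theorem coevaluation_evaluation :
    tensorHom (𝟙 (of X.str.dual)) (coevHom X) ≫ (associator (of X.str.dual) X (of X.str.dual)).inv ≫ tensorHom (evalPairing X) (𝟙 (of X.str.dual)) =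
      (rightUnitor (of X.str.dual)).hom ≫ (leftUnitor (of X.str.dual)).inv := by
  apply hom_ext
  refine TensorProduct.ext' fun ψ q => ?_
  simp only [comp_toLinearMap, LinearMap.comp_apply]
  rw [tensorHom_toLinearMap_apply_tmul, coevHom_toLinearMap_apply, ← LinearEquiv.map_smul, coevaluation_evaluation_aux, map_smul, LinearMap.comp_smul,
    dualTensorHom_coevTensor, LinearMap.comp_id, rightUnitor_hom_toLinearMap_apply_tmul, leftUnitor_inv_toLinearMap_apply]
  rfl

/-! ## §4 The categorical dimension -/

/-- **`δ_X ≫ β ≫ ev_X = (dim_ℚ X) · 𝟙_{ℚ(0)}`**: the composite `ℚ(0) → X ⊗ X^∨ → X^∨ ⊗ X → ℚ(0)` is multiplication by the dimension of `X` (the rank ∕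
categorical dimension of `X`; `ev(Σ eᵢ^* ⊗ eᵢ) = tr(𝟙_X)`). [cite: DeligneMilne1982Tannakian, §1 (1.7.3)–(1.7.5)] -/
theorem coevHom_braiding_evalPairing :
    coevHom X ≫ (braiding X (of X.str.dual)).hom ≫ evalPairing X = (Module.finrank ℚ X : ℚ) • 𝟙 unitObj.{u} := by
  apply hom_ext
  refine LinearMap.ext fun q => ?_
  simp only [comp_toLinearMap, LinearMap.comp_apply]
  rw [coevHom_toLinearMap_apply, map_smul, map_smul]
  have hβ : (braiding X (of X.str.dual)).hom.toLinearMap (TensorProduct.comm ℚ (Module.Dual ℚ X) X (coevTensor X)) = coevTensor X :=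
    (TensorProduct.comm ℚ (Module.Dual ℚ X) X).symm_apply_apply (coevTensor X)
  have hev : (evalPairing X).toLinearMap (coevTensor X) = ULift.up (Module.finrank ℚ X : ℚ) := by
    change uliftRatEquiv.{u}.symm (contractLeft ℚ X (coevTensor X)) = _
    rw [contractLeft_coevTensor]
    rfl
  rw [hβ, hev]
  apply ULift.ext
  change q.down * (Module.finrank ℚ X : ℚ) = (Module.finrank ℚ X : ℚ) * q.down
  exact mul_comm _ _

end MixedHodgeStructureCat

end Literature.AlgebraicGeometry.Motives
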